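import Literature.AnabelianGeometry.EtaleTheta.Discharge.Sec5Prop55HPprojAtSettingQ
import Literature.AnabelianGeometry.EtaleTheta.Discharge.Sec5LDeltaMapLawsOfStub

/-!
# [EtTh] Prop. 5.5 / Thm. 5.6 (i) at the §5 data OF THE SETTING, print's `Q`: the `(Q, P)`-binder kit
# {hpre, hcov', hgeom, hcovHB, hLc, hLi, hproj, (e, he, hPproj)} DISCHARGED modulo the two pins on `P` at `B_N^bs`

Mochizuki, *The étale theta function and its Frobenioid-theoretic manifestations*, Publ. RIMS **45** (2009), §5 p. 327 (PDF p. 101)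
("these subquotients determine subquotients `Aut_D(D) ↠ Aut^Θ_D(D)`; `(l·Δ_Θ)_D ⊆ Aut^Θ_D(D)`"), proof of Prop. 5.5 pp. 327–328 (PDF
pp. 101–102), Thm. 5.6 pp. 328–329 (PDF pp. 102–103).  [cite: MochizukiEtTh2009, Prop 5.5 p.327–328 (PDF pp.101–102)]

PROOF-ONLY (no definitions; nothing of the producers restated).  abc-iut cell, layer L2, seat abc-iut-L2-t9 (gen 4; unit W2-L2-05 lineage),
sequel of `Sec5Prop55HPprojAtSettingQ.lean` (p445332).  THE PRINT'S-`Q` TWIN of the `(Q, P)`-side of abc-iut-w5-d034's level-`N` end knit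
(`Sec5Thm56EndKnitLevelN.lean`, p442234: hpre / hcov' / hcovHB / hgeom / hLc / hLi at `Q := RD.levelStub ιX`) and of abc-iut-w4-d042's
complement (`Sec5Thm56EndKnitLevelNProjPin.lean`, p444002: e / he / hPproj / hproj under the projection pin), READ AT THE JUNCTION OBJECT of
W3-L2-01: abc-iut-L2-t4's `𝔉 := ofThetaSettingDataQ μ hC hS h R K' …` (`Discharge/Sec5OfThetaSettingQ.lean`, p435623) — the §5 data of the §1
Setting with `Q := (l·Δ_Θ)_(−)` PINNED to print's pair `(q, ι) = ((Π^tp_X ↠ (Π^tp_X)^Θ)|_{Π^tp_X̲̲}, l·Δ_Θ ↪ (Π^tp_X)^Θ)` (abc-iut-L2-t9's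
`ofSettingSub D l C.Huu`), `RD := C.rigidData μ hC hS h15 L` (abc-iut-L2-t8), `ιX := id`, and ANY `P : ThetaSubquotientProj 𝔉` PINNED AT `B_N^bs`:

  `hPpre      : P.pre B_N^bs = (autPre q ι (B_N^bs)).comap (Aut_D(B_N^bs) ↪ Aut(B_N^bs.obj))`              (abc-iut-w4-d042's pin, print's `Q`)
  `hPproj_pin : ∀ (σ : P.pre B_N^bs) (τ : autPre q ι (B_N^bs)), mapAut σ = τ → P.proj B_N^bs σ = autProj q ι (B_N^bs) τ`   (cast-free form)

In EXACTLY the binder types of abc-iut-L2-t4's Prop. 5.5 (`cyclotomicRigidity_ofConnectedTemperoidData_of_pullRoot`, p430047) / the K4 end knit and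
capstone (p437581 / p437877 / p437254), read at `(X, RD, ιX) := (Π^tp_X̲̲, C.rigidData μ hC hS h15 L, id)`:
* `hpre_ofThetaSettingDataQ_of_pin` — `k ∈ Π^tp_Ÿ̲̲ ∩ (l·Δ_Θ) ⇒ ρ k ∈ P_{B_N^bs}` (⟸ `hPpre`; abc-iut-L2-t9 p445332 / abc-iut-L2-t4 p435623);
* `hcov'_ofThetaSettingDataQ_of_pin` — EVERY element of `P_{B_N^bs}` is `ρ k`, `k ∈ Π^tp_Ÿ̲̲ ∩ (l·Δ_Θ)` (⟸ `hPpre`; abc-iut-L2-t4's pointwise hgeom/hcov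
  `exists_toTheta_mem_eq_mapAut_rho_ofThetaSetting` + `(l·Δ_Θ) ≤ Π^tp_Ÿ̲̲` — `RigidData.lDeltaTheta_le`);
* `hgeom_ofThetaSettingDataQ_of_pin` — `P_{B_N^bs} ≤ ρ(Ker aug)` (`(l·Δ_Θ) ≤ Δ^tp`);
* `hcovHB_ofThetaSettingDataQ_of_pin` — an element of `H_{B_N}` lying in `P_{B_N^bs}` IS `ρ y`, `y ∈ Π^tp_Ÿ̲̲ ∩ (l·Δ_Θ)`;
* `lDeltaMapLaws_ofThetaSettingDataQ` — `hLc ∧ hLi` (the data's stub IS abc-iut-L2-t9's R2 instance at `(q, ι)`, `rfl` — p438458), NO pin;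
* `hproj_ofThetaSettingDataQ_of_pins` — the structural leaf `𝔉.lDeltaMap g (P.proj g′) = P.proj (g g′ g⁻¹)` at `B_N^bs` (⟸ both pins; abc-iut-w4-d042's
  conjugation law `ThetaSubquotient.map_autProj_eq_autProj_conj`, p429126);
* `exists_coeffMap_ofThetaSettingDataQ_of_projPin` — `(e, he, hPproj)` (⟸ both pins; abc-iut-L2-t9's `exists_coeffMap_autProj_ofThetaSetting`, p445332 —
  there the projection pin was taken in the un-bundled form `∀ σ h₁ h₂, P.proj ⟨σ, h₁⟩ = autProj ⟨mapAut σ, h₂⟩`; here in the cell's cast-free form).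
NET: at the junction object the `(Q, P)`-binders of the (C2) list of `plan/L2/SUBDAG-EtTh-Thm56.md` are ALL theorems modulo the two pin equations
on `P` at `B_N^bs`; a print's-`Q` END KNIT at the Setting is then ONE application of abc-iut-w5-d034's `…_final_deltaCompat` (p437877).

WHY PINNED AND NOT PACKAGED (honest; GAP-LEDGER G-w4d042g3-1, census B1): abc-iut-L2-t4's frozen `ThetaSubquotientProj 𝔉` asks `proj_surjective`
at EVERY object of `B^temp(Π^tp_X̲̲)⁰`, print's `Aut`-projection is onto at Galois objects (abc-iut-L2-t9 p436169 `DoubleUnderline.autProj_surjective_of_isGaloisObj`);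
no `P` TERM is constructed.  Nothing asserts that [EtTh]'s data exist for an actual curve (`tf` abstract); [EtTh] is refereed; no side taken on
[IUTchIII] Cor. 3.12; typed ≠ proved.
-/

noncomputable section

namespace Literature.AnabelianGeometry.EtaleTheta

open CategoryTheory Opposite FrobenioidCyclotomicRigidity Literature.AlgebraicGeometry.Frobenioids
  Literature.AnabelianGeometry.SemiGraphs Literature.AnabelianGeometry.SemiGraphs.GaloisObjects ThetaSubquotient
open scoped IsMulCommutative

universe v₀

/-! ### 0. Generic (light context): the conjugation law read through `Aut_D(A) ↪ Aut(A.obj)` -/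

namespace ThetaSubquotient

universe u v w'

variable {G : Type u} [Group G] [TopologicalSpace G] {Q : Type v} [Group Q] {Λ : Type w'} [CommGroup Λ]
  (q : G →* Q) (ι : Λ →* Q) [ι.range.Normal]

/-- abc-iut-w4-d042's conjugation law `map_autProj_eq_autProj_conj` (p429126) for automorphisms of an object `A` of `B^temp(Π)⁰` READ IN `Aut(A.obj)`
through the (multiplicative) map `Aut_D(A) → Aut(A.obj)`: the transport along `g` takes `autProj (g′)` to `autProj (g g′ g⁻¹)` — the shape in which the
two pins on a `P : ThetaSubquotientProj` at `B_N^bs` consume it.  [cite: MochizukiEtTh2009, Prop 5.5 proof p.328 (PDF p.102)] -/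
theorem exists_map_autProj_mapAut_conj (A : ConnectedPart (BTemp G)) (g g' : Aut A)
    (hh' : Functor.mapAut A (connectedObjects (BTemp G)).ι g' ∈ autPre q ι A.obj) :
    ∃ hgh' : Functor.mapAut A (connectedObjects (BTemp G)).ι (g * g' * g⁻¹) ∈ autPre q ι A.obj,
      map q ι A.property A.property (Functor.mapAut A (connectedObjects (BTemp G)).ι g).hom (autProj q ι A.obj ⟨_, hh'⟩) =
        autProj q ι A.obj ⟨_, hgh'⟩ := by
  have hconj : Functor.mapAut A (connectedObjects (BTemp G)).ι g * Functor.mapAut A (connectedObjects (BTemp G)).ι g' *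
      (Functor.mapAut A (connectedObjects (BTemp G)).ι g)⁻¹ = Functor.mapAut A (connectedObjects (BTemp G)).ι (g * g' * g⁻¹) := by
    rw [map_mul, map_mul, map_inv]
  have hgh' : Functor.mapAut A (connectedObjects (BTemp G)).ι (g * g' * g⁻¹) ∈ autPre q ι A.obj := by
    rw [← hconj]
    exact conj_mem_autPre q ι A.obj _ hh'
  refine ⟨hgh', ?_⟩
  rw [map_autProj_eq_autProj_conj q ι A.property (Functor.mapAut A (connectedObjects (BTemp G)).ι g) ⟨_, hh'⟩]
  exact congrArg _ (Subtype.ext hconj)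

end ThetaSubquotient

namespace ThetaFrobenioid

section SettingQP

variable {p : ℕ} [Fact p.Prime] {D : ThetaSetting p} {E : D.EtaleThetaData} {l : ℕ} {C : E.DoubleUnderline l}
  {e : D.toTemperedCurve.GroupLevelData} {N : ℕ+} (μ : D.CyclotomeMod l N) (hC : D.Compat) (hS : D.Sec2Hyps)
  {D₀ : Type} [Category.{v₀} D₀] {V : FrdIMonoidStub.{0}} {T₀ : RealifiedDivisorMonoids (D₀ := D₀) V}
  {VD : FrdICatStub.{1, 0, 0} (ConnectedPart (BTemp (C.temperedArithmeticGroup e).Pi))}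
  {tf : TemperedFrobenioid T₀ (ConnectedPart (BTemp (C.temperedArithmeticGroup e).Pi)) VD} {hZ : tf.monoidType = MonoidType.Z}
  {hP : ∀ A : (ConnectedPart (BTemp (C.temperedArithmeticGroup e).Pi))ᵒᵖ, IsPerfect (tf.Φ.carrier A)}
  {NH : Subgroup (Field.absoluteGaloisGroup D.K) → tf.category → ℕ+ → Prop} {A₀ : tf.category}
  {hA₀ : PreFrobenioid.IsFrobeniusTrivial tf.toElem A₀} {hA₀' : SemiGraphs.IsGaloisObj A₀.base.obj}
  {pullFrac : ∀ {A A' : (BiKummerSetting.mkOfConnectedTemperoid (C.temperedArithmeticGroup e) tf hZ hP NH A₀ hA₀ hA₀').C} (_ : A' ⟶ A),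
    (BiKummerSetting.mkOfConnectedTemperoid (C.temperedArithmeticGroup e) tf hZ hP NH A₀ hA₀ hA₀').biratUnits A →
      (BiKummerSetting.mkOfConnectedTemperoid (C.temperedArithmeticGroup e) tf hZ hP NH A₀ hA₀ hA₀').biratUnits A'}
  {θ : (BiKummerSetting.mkOfConnectedTemperoid (C.temperedArithmeticGroup e) tf hZ hP NH A₀ hA₀ hA₀').biratUnits
    (BiKummerSetting.mkOfConnectedTemperoid (C.temperedArithmeticGroup e) tf hZ hP NH A₀ hA₀ hA₀').Aodot}
  {Bl : (BiKummerSetting.mkOfConnectedTemperoid (C.temperedArithmeticGroup e) tf hZ hP NH A₀ hA₀ hA₀').C}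
  {Pl : (BiKummerSetting.mkOfConnectedTemperoid (C.temperedArithmeticGroup e) tf hZ hP NH A₀ hA₀ hA₀').FractionPair θ Bl}
  {Rl : (BiKummerSetting.mkOfConnectedTemperoid (C.temperedArithmeticGroup e) tf hZ hP NH A₀ hA₀ hA₀').NthRoot θ Pl C.lPNat pullFrac}
  (h : ModelFrobenioid.Hypotheses tf.divisorMonoid tf.ratFnFunctor)
  (R : (BiKummerSetting.mkOfConnectedTemperoid (C.temperedArithmeticGroup e) tf hZ hP NH A₀ hA₀ hA₀').NthRoot Rl.root Rl.pair N pullFrac)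
  (K' : Type) [Field K'] (constEmb : K'ˣ →* tf.biratUnitsModel R.BN) (constEmb_injective : Function.Injective constEmb)
  (hinvc : ∀ g : Aut R.AN.base,
    pull tf.divisorMonoid g.hom (ModelFrobenioid.div R.pair.num) = ModelFrobenioid.div R.pair.num)
  (hinvp : ∀ y : (C.thetaEnvData μ hC hS).PiX, y ∈ (C.thetaEnvData μ hC hS).PiYdd →
    pull tf.divisorMonoid ((BiKummerSetting.mkOfConnectedTemperoid (C.temperedArithmeticGroup e) tf hZ hP NH A₀ hA₀ hA₀').galoisSurj
      R.AN.base R.αData.isGalois ((ContinuousMulEquiv.refl _) y)).hom (ModelFrobenioid.div R.pair.den) = ModelFrobenioid.div R.pair.den)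
  (h15 : ThetaSetting.Prop15iii E hC) (L : C.CuspLabels)
  (P : ThetaSubquotientProj (ofThetaSettingDataQ μ hC hS h R K' constEmb constEmb_injective hinvc hinvp))
  (hPpre : P.pre R.BN.base = (autPre (qSub D C.Huu) (ιTheta D l) R.BN.base.obj).comap
    (Functor.mapAut R.BN.base (connectedObjects (BTemp (C.temperedArithmeticGroup e).Pi)).ι))

/-! ### 1. The stub laws: no pin needed -/

/-- **`hLc ∧ hLi` at the junction object**: the theta-subquotient stub of `ofThetaSettingDataQ` IS abc-iut-L2-t9's R2 instance at print's `(q, ι)`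
(abc-iut-L2-t4's `ofThetaSettingDataQ_toThetaSubquotientStub`, `rfl`), whose functoriality laws hold (abc-iut-w5-d020 p418890 via abc-iut-L2-t9 p438458).
[cite: MochizukiEtTh2009, §5 p.327 (PDF p.101)] -/
theorem lDeltaMapLaws_ofThetaSettingDataQ :
    Thm56Sub.LDeltaMapComp (ofThetaSettingDataQ μ hC hS h R K' constEmb constEmb_injective hinvc hinvp) ∧
      Thm56Sub.LDeltaMapId (ofThetaSettingDataQ μ hC hS h R K' constEmb constEmb_injective hinvc hinvp) :=
  Thm56Sub.lDeltaMapLaws_of_stub_eq_thetaSubquotientStub (qSub D C.Huu) (ιTheta D l) _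
    (ofThetaSettingDataQ_toThetaSubquotientStub μ hC hS h R K' constEmb constEmb_injective hinvc hinvp)

/-- The transport of `ofThetaSettingDataQ` along a morphism `f` of connected objects IS abc-iut-L2-t9's push-forward `map q ι` along the underlying
map (the data's stub is `ofSettingSub D l C.Huu`, abc-iut-L2-t4's `ofThetaSettingDataQ_toThetaSubquotientStub`; `ofSettingSub_lDeltaMap`) — `rfl`,
recorded so that consumers rewrite instead of unfolding the §5 data.  [cite: MochizukiEtTh2009, §5 p.327 (PDF p.101)] -/
theorem ofThetaSettingDataQ_lDeltaMap {F F' : ConnectedPart (BTemp (C.temperedArithmeticGroup e).Pi)} (f : F ⟶ F')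
    (c : (ofThetaSettingDataQ μ hC hS h R K' constEmb constEmb_injective hinvc hinvp).lDelta F) :
    (ofThetaSettingDataQ μ hC hS h R K' constEmb constEmb_injective hinvc hinvp).lDeltaMap f c =
      map (qSub D C.Huu) (ιTheta D l) F.property F'.property f.hom c := rfl

/-! ### 2. The laws of `(P, ρ)` at `B_N^bs` under the domain pin `hPpre` -/

include hPpre

/-- **hpre at the junction object** (⟸ `hPpre`): for `k ∈ Π^tp_Ÿ̲̲` with `k ∈ RD.lDeltaTheta` (⟺ `toTheta k ∈ l·Δ_Θ`, abc-iut-L2-t4's `Iff.rfl`),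
`ρ k ∈ P_{B_N^bs}` — in the binder type of p430047 / p437254.  [cite: MochizukiEtTh2009, §5 p.327 (PDF p.101)] -/
theorem hpre_ofThetaSettingDataQ_of_pin :
    ∀ k : (C.rigidData μ hC hS h15 L).PiYdd, (k : (C.rigidData μ hC hS h15 L).PiX) ∈ (C.rigidData μ hC hS h15 L).lDeltaTheta →
      rhoOfBiKummerData (T := C.thetaEnvData μ hC hS) R (ContinuousMulEquiv.refl _) k ∈ P.pre R.BN.base := by
  intro k hk
  rw [hPpre]
  exact mapAut_rho_mem_autPre_ofThetaSetting_of_mem μ hC hS R k hk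

/-- **hcov' at the junction object** (⟸ `hPpre`): EVERY element of `P_{B_N^bs}` is `ρ k` for some `k ∈ Π^tp_Ÿ̲̲` with `k ∈ RD.lDeltaTheta`
(abc-iut-L2-t4's pointwise `exists_toTheta_mem_eq_mapAut_rho_ofThetaSetting` + `(l·Δ_Θ) ≤ Π^tp_Ÿ̲̲`, `RigidData.lDeltaTheta_le`; the passage
`mapAut (ρ k) = mapAut g ⇒ ρ k = g` is faithfulness of `Aut_D(B_N^bs) ↪ Aut(B_N^bs.obj)`).
[cite: MochizukiEtTh2009, Prop 5.5 proof p.327–328 (PDF pp.101–102)] -/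
theorem hcov'_ofThetaSettingDataQ_of_pin :
    ∀ g ∈ P.pre ((ofThetaSettingDataQ μ hC hS h R K' constEmb constEmb_injective hinvc hinvp).base.obj
        (ofThetaSettingDataQ μ hC hS h R K' constEmb constEmb_injective hinvc hinvp).BN),
      ∃ k : (C.rigidData μ hC hS h15 L).PiYdd, (k : (C.rigidData μ hC hS h15 L).PiX) ∈ (C.rigidData μ hC hS h15 L).lDeltaTheta ∧
        rhoOfBiKummerData (T := C.thetaEnvData μ hC hS) R (ContinuousMulEquiv.refl _) k = g := by
  intro g hg
  have hg' : g ∈ P.pre R.BN.base := hg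
  rw [hPpre] at hg'
  have H := exists_toTheta_mem_eq_mapAut_rho_ofThetaSetting μ hC hS h R K' constEmb constEmb_injective hinvc hinvp hg'
  obtain ⟨k, hk, hρ⟩ := H
  exact ⟨⟨k, ((C.rigidData μ hC hS h15 L).lDeltaTheta_le hk).1⟩, hk, Iso.ext (ObjectProperty.hom_ext _ (congrArg Iso.hom hρ))⟩

/-- **hgeom at the junction object** (⟸ `hPpre`): `P_{B_N^bs} ≤ ρ(Ker aug)` (`(l·Δ_Θ) ≤ Δ^tp_{X̲̲}`, `RigidData.lDeltaTheta_le`).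
[cite: MochizukiEtTh2009, §5 p.327 (PDF p.101); §2 p.45] -/
theorem hgeom_ofThetaSettingDataQ_of_pin :
    P.pre R.BN.base ≤ (C.rigidData μ hC hS h15 L).aug.ker.map
      (rhoOfBiKummerData (T := C.thetaEnvData μ hC hS) R (ContinuousMulEquiv.refl _)) := by
  intro g hg
  have H := hcov'_ofThetaSettingDataQ_of_pin μ hC hS h R K' constEmb constEmb_injective hinvc hinvp h15 L P hPpre g hg
  obtain ⟨k, hk, hρ⟩ := H
  exact ⟨k, ((C.rigidData μ hC hS h15 L).lDeltaTheta_le hk).2, hρ⟩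

/-- **hcovHB at the junction object** (⟸ `hPpre`): an element of `H_{B_N} = ρ(Π^tp_Ÿ̲̲)` lying in `P_{B_N^bs}` IS `ρ y` with `y ∈ Π^tp_Ÿ̲̲ ∩ (l·Δ_Θ)`
(`𝔉.ρ = ρ` definitionally) — NO lift inside `H_⊙` needed.  [cite: MochizukiEtTh2009, Prop 5.5 proof p.327–328 (PDF pp.101–102)] -/
theorem hcovHB_ofThetaSettingDataQ_of_pin :
    ∀ k : (ofThetaSettingDataQ μ hC hS h R K' constEmb constEmb_injective hinvc hinvp).HB,
      (k : Aut ((ofThetaSettingDataQ μ hC hS h R K' constEmb constEmb_injective hinvc hinvp).base.obj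
        (ofThetaSettingDataQ μ hC hS h R K' constEmb constEmb_injective hinvc hinvp).BN)) ∈ P.pre _ →
      ∃ (y : (C.rigidData μ hC hS h15 L).PiX) (_ : y ∈ (C.rigidData μ hC hS h15 L).PiYdd),
        (ofThetaSettingDataQ μ hC hS h R K' constEmb constEmb_injective hinvc hinvp).ρ y = k ∧
          y ∈ (C.rigidData μ hC hS h15 L).lDeltaTheta := by
  intro k hm
  have H := hcov'_ofThetaSettingDataQ_of_pin μ hC hS h R K' constEmb constEmb_injective hinvc hinvp h15 L P hPpre _ hm
  obtain ⟨y, hy, hρ⟩ := H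
  exact ⟨y, y.2, hρ, hy⟩

/-! ### 3. Under both pins: the structural leaf `hproj` and the coefficient map `(e, he, hPproj)` -/

/-- **hproj at the junction object** (⟸ both pins): `𝔉.lDeltaMap g (P.proj g′) = P.proj (g g′ g⁻¹)` at `B_N^bs` — abc-iut-w4-d042's conjugation law
`ThetaSubquotient.map_autProj_eq_autProj_conj` (p429126) read through the `rfl` dictionary (`𝔉.lDeltaMap` at the pinned stub IS abc-iut-L2-t9's
transport `map q ι`) and the two pins; the print's-`Q` twin of abc-iut-w4-d042's `hproj_levelStub_of_pins` (p444002).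
[cite: MochizukiEtTh2009, Prop 5.5 proof p.328 (PDF p.102)] -/
theorem hproj_ofThetaSettingDataQ_of_pins
    (hPproj_pin : ∀ (σ : P.pre R.BN.base) (τ : autPre (qSub D C.Huu) (ιTheta D l) R.BN.base.obj),
      Functor.mapAut R.BN.base (connectedObjects (BTemp (C.temperedArithmeticGroup e).Pi)).ι σ.1 = τ.1 →
        P.proj R.BN.base σ = autProj (qSub D C.Huu) (ιTheta D l) R.BN.base.obj τ)
    (g g' : Aut R.BN.base) (hh : g' ∈ P.pre R.BN.base) :
    ∃ hgh : g * g' * g⁻¹ ∈ P.pre R.BN.base,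
      (ofThetaSettingDataQ μ hC hS h R K' constEmb constEmb_injective hinvc hinvp).lDeltaMap g.hom (P.proj R.BN.base ⟨g', hh⟩) =
        P.proj R.BN.base ⟨g * g' * g⁻¹, hgh⟩ := by
  have hh' : Functor.mapAut R.BN.base (connectedObjects (BTemp (C.temperedArithmeticGroup e).Pi)).ι g' ∈
      autPre (qSub D C.Huu) (ιTheta D l) R.BN.base.obj := by
    rw [hPpre] at hh
    exact hh
  have H := exists_map_autProj_mapAut_conj (qSub D C.Huu) (ιTheta D l) R.BN.base g g' hh'
  obtain ⟨hgh', h3⟩ := H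
  have hgh : g * g' * g⁻¹ ∈ P.pre R.BN.base := by
    rw [hPpre]
    exact hgh'
  refine ⟨hgh, ?_⟩
  have h1 := hPproj_pin ⟨g', hh⟩ ⟨_, hh'⟩ rfl
  have h2 := hPproj_pin ⟨g * g' * g⁻¹, hgh⟩ ⟨_, hgh'⟩ rfl
  -- term-mode chain (no `rw` on the goal: its motive type-checks exceed the default heartbeat budget at these data)
  have h4 := (congrArg (fun c => (ofThetaSettingDataQ μ hC hS h R K' constEmb constEmb_injective hinvc hinvp).lDeltaMap g.hom c) h1).trans
    ((ofThetaSettingDataQ_lDeltaMap μ hC hS h R K' constEmb constEmb_injective hinvc hinvp g.hom _).trans h3)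
  exact h4.trans h2.symm

/-- **`(e, he, hPproj)` at the junction object under both pins** (the cell's cast-free projection pin): there is a SURJECTIVE
`e : μ_N → (l·Δ_Θ)_{B_N} ⊗ ℤ/Nℤ` with `mk (P.proj (ρ k)) = e (thetaMod k)` for every `k ∈ Π^tp_Ÿ̲̲ ∩ (l·Δ_Θ)` — abc-iut-L2-t9's
`exists_coeffMap_autProj_ofThetaSetting` (p445332) read on `P` through the pins ("`l·Δ_Θ ↠ (l·Δ_Θ) ⊗ ℤ/Nℤ ≅ μ_N`", p.46).
[cite: MochizukiEtTh2009, Prop 5.5 p.327–328 (PDF pp.101–102); §2 p.272 (PDF p.46)] -/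
theorem exists_coeffMap_ofThetaSettingDataQ_of_projPin
    (hPproj_pin : ∀ (σ : P.pre R.BN.base) (τ : autPre (qSub D C.Huu) (ιTheta D l) R.BN.base.obj),
      Functor.mapAut R.BN.base (connectedObjects (BTemp (C.temperedArithmeticGroup e).Pi)).ι σ.1 = τ.1 →
        P.proj R.BN.base σ = autProj (qSub D C.Huu) (ιTheta D l) R.BN.base.obj τ) :
    ∃ ec : (C.rigidData μ hC hS h15 L).mu →
        (ofThetaSettingDataQ μ hC hS h R K' constEmb constEmb_injective hinvc hinvp).lDeltaModN
          (ofThetaSettingDataQ μ hC hS h R K' constEmb constEmb_injective hinvc hinvp).BN,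
      Function.Surjective ec ∧
        ∀ (k : (C.rigidData μ hC hS h15 L).PiYdd) (hk : (k : (C.rigidData μ hC hS h15 L).PiX) ∈ (C.rigidData μ hC hS h15 L).lDeltaTheta)
          (hm : rhoOfBiKummerData (T := C.thetaEnvData μ hC hS) R (ContinuousMulEquiv.refl _) k ∈ P.pre _),
          (QuotientGroup.mk (P.proj _ ⟨rhoOfBiKummerData (T := C.thetaEnvData μ hC hS) R (ContinuousMulEquiv.refl _) k, hm⟩) :
              (ofThetaSettingDataQ μ hC hS h R K' constEmb constEmb_injective hinvc hinvp).lDeltaModN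
                (ofThetaSettingDataQ μ hC hS h R K' constEmb constEmb_injective hinvc hinvp).BN) =
            ec ((C.rigidData μ hC hS h15 L).thetaMod ⟨k, hk⟩) :=
  exists_coeffMap_ofThetaSettingDataQ μ hC hS R h K' constEmb constEmb_injective hinvc hinvp h15 L P hPpre
    (fun σ h₁ h₂ => hPproj_pin ⟨σ, h₁⟩ ⟨_, h₂⟩ rfl)

end SettingQP

end ThetaFrobenioid

end Literature.AnabelianGeometry.EtaleTheta

end
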